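import Summits.ResolutionOfSingularities.ResolutionOfSingularities.Theorems.EquisingularLiftEquisingularLiftNatSubchainPointResolutionOff
import Literature.AlgebraicGeometry.Resolution.BlowupAlgebraPresentation
import HarnessLib

/-!
# [OURS · L1 W4.5(b) · EL♮(3)] HSUB′(ReachTC⁺) — THE INVARIANT of the inner chain (definitions)
# `TCPlus.CentredPackage`, `TCPlus.Member`, `TCPlus.Inv` (registered stub `stub_elnat_tcPlusPointResolution`, v7.1 / child v4.1;
# driver `hsub_reachTCPlus_of_invariant` p526242; skeleton `L/res-L1-w45b-stub-1/HSUB-TCPLUS3-skeleton.lean`)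

v3 (2026-08-27T12:30Z) by res-L1-w45b-stub-1 (HSUB(ReachTC⁺) assembly, res-L1-w45b-lead-2 GO 2026-08-27T10:45:46Z). OURS; NOT a statement of any
manuscript; AI-written, weaker than expert review. Definitions only (no theorem); intended as the reviewed `…Defs` file whose
predicates the four bricks of the driver (`inv_base`, `inv_step_regular`, `inv_step_singular`, `inv_final`) share.

* `TCPlus.CentredPackage` — at an `O`-point `p` of the stage `X` (base `r : X → Spec O`): a SECTION `s_c` through `p` lying on the
  in-carrier surface `D = V(𝓢 ⊔ K)`, a frame `c : Fin 3 → 𝒪_{X,p}` of `(ker s_c)_p` with `c₀` generating `𝓢_p` and the CARRIER CONE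
  PACK of order `m` for `K` (res-L1-w45b-stub-1 …NatCarrierStrictTransformStalks p522194 currency: `K_p = (Φ(c₁,c₂))`, `Φ` a form of
  degree `m`, `Φ mod (c) ≠ 0`, the tail `c̄′` quasi-regular mod `c₀`), EXACT at the special point (`Φ mod 𝔪_p ≠ 0`), and the
  Δ-REGULARITY AFTER THE BLOW-UP of `s_c` in the INTRINSIC form `TCPlus.ConeDeltaRegular c Φ` (regular localizations of the
  chart algebras `A[c/c_j] ⧸ (c₀/c_j, Φ(c′/c_j))` at primes over `𝔪_p`; turned into regular quotient stalks of `St(𝓢) ⊔ St(K)`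
  over `p` for ANY blow-up of the section by p522194, and transported along the stalk isomorphisms of regular steps elsewhere —
  v2 2026-08-27T12:00Z: the v1 clause «∀ blow-ups τ of X along ker s_c …» did not transport, `Bl_{s′} Bl_s X` not being a
  blow-up of `X` along `s′`);
* `TCPlus.Member` — a `Ch`-stage `(X, σ, S)` with a model square `jG : G → X` over `Spec θ`, `jG '' T = S`, and an IN-CARRIER PAIR
  `(𝓢, K)` of locally principal ideal sheaves with: (i) `(𝓢 ⊔ K).comap jG = 𝓘⟨closure Z⟩` (exact special fibre), (ii) `V(𝓢 ⊔ K) → Spec O`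
  flat, (iii) `V(𝓢)` regular, (iv) `σ '' supp (𝓢 ⊔ K)` off the generic points of `Y`, (v) regular quotient stalks at every special
  point of `V(𝓢 ⊔ K)` NOT in `jG '' excl`, of codimension `2` at the closed ones (v3: pins `D` to a surface — with `dim 𝒪_{X,z} = 3 + 1`
  at closed special points of a stage, …NatStalkDimension, this is `dim 𝒪_{D,z} = 2`, whence `h ∉ 𝔪_z²`, `f ∉ (h) + 𝔪_z²` for the
  local equations, the input of the order-one cone packs …NatConePackDegreeOne / F⁺5 p519966), (vi) a `CentredPackage` at `jG y₀` for every `y₀ ∈ excl`;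
* `TCPlus.Inv` — the driver's `INV W G β T Z b`: `G` integral, `T` closed irreducible and NOT inside `closure Z` (v2: keeps `T`
  irreducible through point steps at points of `closure Z`), SOME member with `excl = ∅` (the uncentred member before the flag,
  the survivor after it), and — while `b = false` — for every CLOSED NON-REGULAR point `y′` of the reduced
  curve `V(closure Z)_red` a member with `excl = {y′}` (centred there). (`β` and `W` are not used by the predicate itself; they are
  binders of the driver.)
-/

set_option linter.dupNamespace false -- mandated namespace `Summit.<Summit>.<Problem>` of this single-conjunct summit
set_option linter.overlappingInstances false -- signatures carry `[IsDomain O] [IsDiscreteValuationRing O]`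

noncomputable section

open CategoryTheory CategoryTheory.Limits AlgebraicGeometry TopologicalSpace Topology IsLocalRing
open Literature.AlgebraicGeometry.Resolution
open AlgebraicGeometry.Scheme.IdealSheafData

namespace Summit.ResolutionOfSingularities.ResolutionOfSingularities.Cruxes.EquisingularLiftNat.Sections.TCPlus

universe u

variable (O : Type) [CommRing O] [IsDomain O] [IsDiscreteValuationRing O] (k : Type) [Field k] (θ : O →+* k)
  (P : Scheme.{0}) (q : P ⟶ Spec (.of O)) (Y : Set P) (Ch : ∀ X' : Scheme.{0}, (X' ⟶ P) → Set X' → Prop)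

/-- **Δ-regularity of cone data `(A, c, Φ)`, intrinsic form.** `A` local, `c : Fin (r+1) → A` a frame (carrier `c₀`, tail
`c′`), `Φ ∈ A[T₁,…,T_r]` the cone form with `K = (Φ(c′))`. On the chart `c_{j'+1}` of the blow-up algebra
`B = A[c/c_{j'+1}]` the strict transforms of the carrier and of the cone are `e₀ = c₀/c_{j'+1}` and `Φ(e′)`, `e′_l = c_{l+1}/c_{j'+1}`
(res-L1-w45b-stub-1 …NatCarrierStrictTransformStalks p522194: for ANY blow-up `τ` along an ideal with stalk `(c)` at `p` and any
point `z` over `p` on `V(St 𝓢)`, `𝒪_{X',z}` is a localization `B_𝔔` with `(St 𝓢 ⊔ St K)_z = (e₀, Φ(e′))`). The condition: for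
every prime `𝔔` of `B` over `𝔪_A` containing `e₀` and `Φ(e′)` and every model `S` of `B_𝔔`, `S ⧸ (e₀, Φ(e′))` is a regular local
ring of codimension `2` in `S`. Being a statement about `(A, c, Φ)` alone, it is transported along ring isomorphisms `A ≅ A₂` (the stalk maps of a blow-up
that is an isomorphism near `p`). [OURS · L1 W4.5b] -/
def ConeDeltaRegular {A : Type u} [CommRing A] [IsLocalRing A] {r : ℕ} (c : Fin (r + 1) → A) (Φ : MvPolynomial (Fin r) A) :
    Prop :=
  ∀ (j' : Fin r) (𝔔 : Ideal (blowupAlgebra (Ideal.span (Set.range c)) (c j'.succ))) [𝔔.IsPrime],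
    𝔔.comap (algebraMap A (blowupAlgebra (Ideal.span (Set.range c)) (c j'.succ))) = maximalIdeal A →
    blowupAlgebra.frac c j'.succ 0 ∈ 𝔔 →
    MvPolynomial.aeval (fun l : Fin r => blowupAlgebra.frac c j'.succ l.succ) Φ ∈ 𝔔 →
    -- «in any model `S` of the local ring `A[c/c_{j'+1}]_𝔔`» (res-L1-w45b-stub-3's currency, p515745): the stalk itself is one
    ∀ (S : Type u) [CommRing S] [Algebra (blowupAlgebra (Ideal.span (Set.range c)) (c j'.succ)) S]
      [IsLocalization.AtPrime S 𝔔],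
      IsRegularLocalRing (S ⧸ (Ideal.span {algebraMap _ S (blowupAlgebra.frac c j'.succ 0)} ⊔
        Ideal.span {algebraMap _ S (MvPolynomial.aeval (fun l : Fin r => blowupAlgebra.frac c j'.succ l.succ) Φ)})) ∧
      ringKrullDim (S ⧸ (Ideal.span {algebraMap _ S (blowupAlgebra.frac c j'.succ 0)} ⊔
        Ideal.span {algebraMap _ S (MvPolynomial.aeval (fun l : Fin r => blowupAlgebra.frac c j'.succ l.succ) Φ)})) + 2 =
        ringKrullDim S

/-- **The centred package at an `O`-point `p` of the stage `X`** for the in-carrier pair `(𝓢, K)` (see the module docstring).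
[OURS · L1 W4.5b] -/
def CentredPackage (X : Scheme.{0}) (σ : X ⟶ P) (𝓢 K : X.IdealSheafData) (p : X) : Prop :=
  ∃ (s : Spec (.of O) ⟶ X), s ≫ σ ≫ q = 𝟙 _ ∧ s (closedPoint O) = p ∧ 𝓢 ⊔ K ≤ s.ker ∧
    ∃ (c : Fin 3 → X.presheaf.stalk p) (m : ℕ) (Φ : MvPolynomial (Fin 2) (X.presheaf.stalk p)),
      Ideal.span (Set.range c) = stalkIdeal s.ker p ∧ IsQuasiRegular c ∧
      IsDomain (X.presheaf.stalk p ⧸ Ideal.span (Set.range c)) ∧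
      IsQuasiRegular (fun l : Fin 2 => Ideal.Quotient.mk (Ideal.span {c 0}) (c l.succ)) ∧
      stalkIdeal 𝓢 p = Ideal.span {c 0} ∧ 1 ≤ m ∧ Φ.IsHomogeneous m ∧
      stalkIdeal K p = Ideal.span {MvPolynomial.eval (fun l : Fin 2 => c l.succ) Φ} ∧
      MvPolynomial.map (Ideal.Quotient.mk (Ideal.span (Set.range c))) Φ ≠ 0 ∧
      MvPolynomial.map (IsLocalRing.residue (X.presheaf.stalk p)) Φ ≠ 0 ∧
      -- Δ-regularity after the blow-up of the section, at every point over `p` — INTRINSIC form (transports along stalk isos)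
      ConeDeltaRegular c Φ

/-- **A member of the invariant**: an upstairs `Ch`-stage with a model square for the downstairs stage `(G, T)` and an in-carrier
pair `(𝓢, K)` whose sum is the current centre candidate, with the clauses (i)–(vi) of the module docstring; `excl ⊆ G` is the set of
downstairs special points still EXCLUDED from regularity (there the pair is centred). [OURS · L1 W4.5b] -/
def Member (G : Scheme.{0}) (T Z : Set G) (excl : Set G) : Prop :=
  ∃ (X : Scheme.{0}) (σ : X ⟶ P) (S : Set X) (jG : G ⟶ X) (tG : G ⟶ Spec (.of k)) (𝓢 K : X.IdealSheafData),
    Ch X σ S ∧ IsIntegral X ∧ IsLocallyNoetherian X ∧ Scheme.IsRegular X ∧ IsDominant (σ ≫ q) ∧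
    IsPullback jG tG (σ ≫ q) (Spec.map (CommRingCat.ofHom θ)) ∧ jG '' T = S ∧
    -- (i) exact special fibre
    (𝓢 ⊔ K).comap jG = vanishingIdeal (⟨closure Z, isClosed_closure⟩ : Closeds G) ∧
    -- (ii) flat over `O`
    Flat ((𝓢 ⊔ K).subschemeι ≫ σ ≫ q) ∧
    -- (iii) the carrier is regular, both ideal sheaves are locally principal
    Scheme.IsRegular 𝓢.subscheme ∧ (∀ z : X, (stalkIdeal 𝓢 z).IsPrincipal ∧ (stalkIdeal K z).IsPrincipal) ∧
    -- (iv) off the generic point of `Y`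
    σ '' ((𝓢 ⊔ K).support : Set X) ⊆ {y : P | ¬ IsGenericPoint y Y} ∧
    -- (v) regular quotient stalks at the special points, off the excluded ones — of codimension `2` at the closed ones
    (∀ z ∈ ((𝓢 ⊔ K).support : Set X), (σ ≫ q) z = closedPoint O → z ∉ jG '' excl →
      IsRegularLocalRing (X.presheaf.stalk z ⧸ stalkIdeal (𝓢 ⊔ K) z) ∧
      (IsClosed ({z} : Set X) →
        ringKrullDim (X.presheaf.stalk z ⧸ stalkIdeal (𝓢 ⊔ K) z) + 2 = ringKrullDim (X.presheaf.stalk z))) ∧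
    -- (vi) centred packages at the excluded points
    (∀ y₀ ∈ excl, CentredPackage O P q X σ 𝓢 K (jG y₀))

/-- **The invariant `INV W G β T Z b` of the driver `hsub_reachTCPlus_of_invariant`** (p526242): `G` integral, `T` closed
irreducible and not inside `closure Z`, a member with no excluded point, and while no singular point has been blown up (`b = false`) a CENTRED member at
every closed non-regular point of the reduced curve `V(closure Z)_red`. [OURS · L1 W4.5b] -/
def Inv {F₁ F₂ : Scheme.{0}} (_W : Set F₁) (G : Scheme.{0}) (_β : G ⟶ F₂) (T Z : Set G) (b : Bool) : Prop :=
  IsIntegral G ∧ IsClosed T ∧ IsIrreducible T ∧ ¬ T ⊆ closure Z ∧ Member O k θ P q Y Ch G T Z ∅ ∧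
    (b = false → ∀ y : ↥(vanishingIdeal (⟨closure Z, isClosed_closure⟩ : Closeds G)).subscheme,
      IsClosed ({((vanishingIdeal (⟨closure Z, isClosed_closure⟩ : Closeds G)).subschemeι y : G)} : Set G) →
      ¬ IsRegularLocalRing ((vanishingIdeal (⟨closure Z, isClosed_closure⟩ : Closeds G)).subscheme.presheaf.stalk y) →
      Member O k θ P q Y Ch G T Z {((vanishingIdeal (⟨closure Z, isClosed_closure⟩ : Closeds G)).subschemeι y : G)})

end Summit.ResolutionOfSingularities.ResolutionOfSingularities.Cruxes.EquisingularLiftNat.Sections.TCPlus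

end
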